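import Summits.ABC.IUTFork.ForkGenuineRegimesSharp
import Literature.IUT.LogVolume.TensorPacketContentSharpUpper
import HarnessLib

/-!
# The fork at [IUTchIII] Corollary 3.12 at a GENUINE input: the SHARP UPPER window for `−|log(Θ)|` — Step (v) with
# Prop. 1.1's `✱`-exponent (R2 TARGET #1 «Rest_lower», upper companion «PROP12II-SHARP-UPPER»; [IUTchIV] §1, Thm. 1.10 Step (v))

Record-only PROOF file (D-0012) of the abc-iut cell (seat abc-iut-w6-d018); TAKES NO SIDE. Sequel to `ForkGenuineWindow`
(abc-iut-skel/w5-d082: `negLogThetaNonarch_le_upperWindow`, per collection `{d_I + 1 + 4|I*|/p}·log p` above `−min_a θ + δ_Λ`),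
to this lineage's SHARP LOWER window (`ForkGenuineWindowSharp`, S4's `ForkGenuineWindowSharpExplicit`: the genuine volume
REALISES `d_I − min_J d_{L_J} ≥ d_I − Σ_{u|p} d(K_{u̲})` per collection) and to the packet-level UPPER end with Prop. 1.1's
`✱`-exponent (`TensorPacketContentSharpUpper.packetLogμ_packetHull_orbit_le_star'`, on abc-iut-w4-d006's `TensorPacketLogStar`:
`log μ̄(hull(⋃_γ γ·M)) ≤ (−λ_min + d_I − d_✱ + a_I + b_I + 1)·log p` for EVERY slot `✱`). HERE, summed over the input:

* `logμ_le_neg_thetaMin_add_star` — per collection `v⃗ ∈ V(F₀)_p^{j+1}` and EVERY slot `✱`: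
  `log μ̄_{v⃗}(Θ-hull) ≤ −min_a θ_j(v_a) + (d_I(v⃗) − d_{v_✱} + a_I(v⃗) + b_I(v⃗) + 1)·log p`; `logμ_le_neg_thetaMin_add_sup` — with
  the slot of LARGEST different: `… + (d_I(v⃗) − max_b d_{v_b} + a_I + b_I + 1)·log p`;
* **`negLogThetaNonarch_le_upperWindowSharp`** — `negLogThetaNonarch I ≤ −ndegLgpSlotMin(T(I)) + U♯(I)`,
  `U♯(I) := Σ_{p∈T(I)} (1/ℓ⋇)·Σ_j Σ_{v⃗} (d_I(v⃗) − max_b d_{v_b} + a_I(v⃗) + b_I(v⃗) + 1)·log p·Π_b Pr(v_b)` (inline);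
* **`hullEstimateOf_slotResidue_add_upperSharp`** — hence `HullEstimateOf I (slotResidue(T(I)) + U♯(I))` UNCONDITIONALLY (the
  computable half with the `✱`-sharpened constant; compare c312-d1's `hullEstimateOf_slotResidue_add_rest` with
  `explicitDeltaRest = Σ(d_I + 1 + Σ_{e_a>p−2}{3+log e_a})·log p·Π Pr/ℓ⋇`);
* **`hullEstimateOf_window_sharp`** — the TWO-SIDED window with BOTH ends sharp:
  `slotResidue + U♯ ≤ δ ⟹ HullEstimateOf I δ ⟹ slotResidue + D_expl ≤ δ`; the band is
  `U♯ − D_expl = Σ_p (1/ℓ⋇)Σ_jΣ_{v⃗} (Σ_{u|p} d(K_{u̲}) − max_b d_{v_b} + a_I + b_I + 1)·log p·Π Pr` — at a SLOT-CONSTANT prime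
  (one place `u` over `p`, e.g. `F_mod = ℚ`) exactly the tame constants `(a_I + b_I + 1)·log p` per collection: there the typed
  `−|log(Θ)|` is pinned by arithmetic to within `Σ_p (a_I + b_I + 1)`-type constants;
* `gap_le_of_cor312Of_sharp` — the deep side of `ForkGenuineRegimesSharp.cor312Of_sharpRegimes` with `U♯` in place of
  `explicitDeltaRest`: `Cor312Of I ⟹ deĝ̲_lgp(P_Θ) − deĝ̲(P_q) ≤ slotResidue + U♯ + ((l+5)/4)·log π`.
Nothing asserted about any input; (Ind1)/(Ind2)/hull are the tree's typings of the disputed corpus [claim: Mochizuki2012, status: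
disputed]; the volume algebra is classical; no side taken on [IUTchIII] Cor. 3.12; typed ≠ proved. PROOF-ONLY file.
[cite: Mochizuki2012, IUTchIV Prop. 1.1 p. 9, Prop. 1.2 (ii) p. 10–11, Thm. 1.10 Steps (iv)–(viii) p. 26–30]
[cite: DupuyHilado2025, Def. 3.6.3, §4.9, §4.12]
-/

noncomputable section

open Set Literature.IUT.LogVolume NumberField IsDedekindDomain
open scoped Pointwise

namespace Summit.ABC.IUTFork.GenuineContent

section Upper

variable {F₀ : Type} [Field F₀] [NumberField F₀] {K : Type} [Field K] [NumberField K] [Algebra F₀ K]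
variable (I : ThetaVolumeInput F₀ K)

/-! ## 1. Per summand: the `✱`-sharp upper end in θ-currency -/

/-- **Sharp upper end per summand, every slot `✱`**: `log μ̄_{v⃗}(Θ-hull) ≤ −min_a θ_j(v_a) +
(d_I(v⃗) − d_{v_✱} + a_I(v⃗) + b_I(v⃗) + 1)·log p` (the slot-union at `v⃗` is bounded, nonzero, and lies in itself; the slot of
least `θ` has the largest norm; `TensorPacketContentSharpUpper.packetLogμ_packetHull_orbit_le_star'`).
[cite: Mochizuki2012, IUTchIV Thm. 1.10 Step (v) p. 27–28] [cite: DupuyHilado2025, §4.9, §4.12] -/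
theorem logμ_le_neg_thetaMin_add_star {p : ℕ} [hp : Fact p.Prime] (i : Fin I.X.lstar)
    (e : Fin ((i : ℕ) + 1 + 1) → placesOver F₀ p) (star : Fin ((i : ℕ) + 1 + 1)) :
    (realPrimePacketM p (I.σ.localFieldFamily p hp.out)).logμ
        ((realPrimePacketM p (I.σ.localFieldFamily p hp.out)).possibleImagesHull
          ((realPrimePacketM p (I.σ.localFieldFamily p hp.out)).pilotRegion (I.tΘ p hp.out))
            ((i : ℕ) + 1) e) ≤
      -(Finset.univ.inf' ⟨0, Finset.mem_univ _⟩ (fun a =>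
          I.X.thetaPilot i (e a).1 * logNorm F₀ (e a).1 / localDegree F₀ (e a).1))
        + (dSum p (fun b => (I.σ.localFieldFamily p hp.out).k (e b))
            - differentOrd p ((I.σ.localFieldFamily p hp.out).k (e star))
            + aSum p (fun b => (I.σ.localFieldFamily p hp.out).k (e b))
            + bSum p (fun b => (I.σ.localFieldFamily p hp.out).k (e b)) + 1) * Real.log p := by
  obtain ⟨a₀, -, ha₀⟩ := Finset.exists_mem_eq_inf' (⟨0, Finset.mem_univ _⟩ : (Finset.univ :
    Finset (Fin ((i : ℕ) + 1 + 1))).Nonempty)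
    (fun a => I.X.thetaPilot i (e a).1 * logNorm F₀ (e a).1 / localDegree F₀ (e a).1)
  have hmin : ∀ a, I.X.thetaPilot i (e a₀).1 * logNorm F₀ (e a₀).1 / localDegree F₀ (e a₀).1 ≤
      I.X.thetaPilot i (e a).1 * logNorm F₀ (e a).1 / localDegree F₀ (e a).1 := fun a => by
    rw [← ha₀]
    exact Finset.inf'_le _ (Finset.mem_univ a)
  have hmax : ∀ a, ‖(I.tΘ p hp.out i (e a) : (I.σ.localFieldFamily p hp.out).k (e a))‖ ≤
      ‖(I.tΘ p hp.out i (e a₀) : (I.σ.localFieldFamily p hp.out).k (e a₀))‖ := by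
    intro a
    rw [← Real.log_le_log_iff (norm_pos_iff.mpr (I.tΘ p hp.out i (e a)).ne_zero)
      (norm_pos_iff.mpr (I.tΘ p hp.out i (e a₀)).ne_zero), log_norm_tΘ, log_norm_tΘ]
    exact neg_le_neg (hmin a)
  choose mexp hmexp using fun a =>
    exists_norm_eq_rpow p ((I.σ.localFieldFamily p hp.out).k (e a)) (I.tΘ p hp.out i (e a)).ne_zero
  have hmin' : ∀ a, (mexp a₀ : ℝ) / absRamificationIdx p ((I.σ.localFieldFamily p hp.out).k (e a₀)) ≤
      (mexp a : ℝ) / absRamificationIdx p ((I.σ.localFieldFamily p hp.out).k (e a)) :=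
    fun a => slotOrder_le_of_norm_le p (fun b => (I.σ.localFieldFamily p hp.out).k (e b))
      (hmexp a) (hmexp a₀) (hmax a)
  have hw := packetLogμ_packetHull_orbit_le_star' p (fun b => (I.σ.localFieldFamily p hp.out).k (e b)) star
    (isPsiBounded_slotUnion (I.σ.localFieldFamily p hp.out) (I.tΘ p hp.out) i e)
    (exists_ne_zero_mem_slotUnion (I.σ.localFieldFamily p hp.out) (I.tΘ p hp.out) i e)
    (fun a => (I.tΘ p hp.out i (e a) : (I.σ.localFieldFamily p hp.out).k (e a))) mexp hmexp a₀ hmin'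
    Subset.rfl
  have heq : (realPrimePacketM p (I.σ.localFieldFamily p hp.out)).possibleImagesHull
        ((realPrimePacketM p (I.σ.localFieldFamily p hp.out)).pilotRegion (I.tΘ p hp.out)) ((i : ℕ) + 1) e =
      packetHull p (fun b => (I.σ.localFieldFamily p hp.out).k (e b))
        (⋃ γ : indTwo p (fun b => (I.σ.localFieldFamily p hp.out).k (e b)),
          γ • ⋃ a : Fin ((i : ℕ) + 1 + 1), iota p (fun b => (I.σ.localFieldFamily p hp.out).k (e b)) a
            (I.tΘ p hp.out i (e a) : (I.σ.localFieldFamily p hp.out).k (e a)) •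
            (normalizedPacket p (fun b => (I.σ.localFieldFamily p hp.out).k (e b)) :
              Set (PacketAlgebra p (fun b => (I.σ.localFieldFamily p hp.out).k (e b))))) :=
    possibleImagesHull_pilotRegion_eq (I.σ.localFieldFamily p hp.out) (mScale p _) (mScale_ne_zero p _)
      (mScale_perm p _) (I.tΘ p hp.out) i e
  -- `−λ_min·log p = log‖t_{Θ,j,v_{a₀}}‖ = −θ_j(v_{a₀})`
  have hlam : -((mexp a₀ : ℝ) / absRamificationIdx p ((I.σ.localFieldFamily p hp.out).k (e a₀))) * Real.log p =
      -(I.X.thetaPilot i (e a₀).1 * logNorm F₀ (e a₀).1 / localDegree F₀ (e a₀).1) := by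
    have hp0 : (0 : ℝ) < p := by exact_mod_cast hp.out.pos
    have h := congrArg Real.log (hmexp a₀)
    rw [Real.log_rpow hp0, log_norm_tΘ] at h
    linarith
  show packetLogμ p (fun b => (I.σ.localFieldFamily p hp.out).k (e b))
    ((realPrimePacketM p (I.σ.localFieldFamily p hp.out)).possibleImagesHull
      ((realPrimePacketM p (I.σ.localFieldFamily p hp.out)).pilotRegion (I.tΘ p hp.out)) ((i : ℕ) + 1) e) ≤ _
  rw [heq, ha₀]
  have hsplit : (-((mexp a₀ : ℝ) / absRamificationIdx p ((I.σ.localFieldFamily p hp.out).k (e a₀)))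
        + (dSum p (fun b => (I.σ.localFieldFamily p hp.out).k (e b))
            - differentOrd p ((I.σ.localFieldFamily p hp.out).k (e star)))
        + aSum p (fun b => (I.σ.localFieldFamily p hp.out).k (e b))
        + bSum p (fun b => (I.σ.localFieldFamily p hp.out).k (e b)) + 1) * Real.log p =
      -((mexp a₀ : ℝ) / absRamificationIdx p ((I.σ.localFieldFamily p hp.out).k (e a₀))) * Real.log p
        + (dSum p (fun b => (I.σ.localFieldFamily p hp.out).k (e b))
            - differentOrd p ((I.σ.localFieldFamily p hp.out).k (e star))
            + aSum p (fun b => (I.σ.localFieldFamily p hp.out).k (e b))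
            + bSum p (fun b => (I.σ.localFieldFamily p hp.out).k (e b)) + 1) * Real.log p := by ring
  rw [hsplit, hlam] at hw
  exact hw

/-- **Sharp upper end per summand, slot of LARGEST different**: `log μ̄_{v⃗}(Θ-hull) ≤ −min_a θ_j(v_a) +
(d_I(v⃗) − max_b d_{v_b} + a_I(v⃗) + b_I(v⃗) + 1)·log p`. [cite: Mochizuki2012, IUTchIV Thm. 1.10 Step (v) p. 27–28] -/
theorem logμ_le_neg_thetaMin_add_sup {p : ℕ} [hp : Fact p.Prime] (i : Fin I.X.lstar)
    (e : Fin ((i : ℕ) + 1 + 1) → placesOver F₀ p) :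
    (realPrimePacketM p (I.σ.localFieldFamily p hp.out)).logμ
        ((realPrimePacketM p (I.σ.localFieldFamily p hp.out)).possibleImagesHull
          ((realPrimePacketM p (I.σ.localFieldFamily p hp.out)).pilotRegion (I.tΘ p hp.out))
            ((i : ℕ) + 1) e) ≤
      -(Finset.univ.inf' ⟨0, Finset.mem_univ _⟩ (fun a =>
          I.X.thetaPilot i (e a).1 * logNorm F₀ (e a).1 / localDegree F₀ (e a).1))
        + (dSum p (fun b => (I.σ.localFieldFamily p hp.out).k (e b))
            - Finset.univ.sup' ⟨0, Finset.mem_univ _⟩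
                (fun b => differentOrd p ((I.σ.localFieldFamily p hp.out).k (e b)))
            + aSum p (fun b => (I.σ.localFieldFamily p hp.out).k (e b))
            + bSum p (fun b => (I.σ.localFieldFamily p hp.out).k (e b)) + 1) * Real.log p := by
  obtain ⟨b₀, -, hb₀⟩ := Finset.exists_mem_eq_sup' (⟨0, Finset.mem_univ _⟩ : (Finset.univ :
    Finset (Fin ((i : ℕ) + 1 + 1))).Nonempty) (fun b => differentOrd p ((I.σ.localFieldFamily p hp.out).k (e b)))
  rw [hb₀]
  exact logμ_le_neg_thetaMin_add_star I i e b₀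

/-! ## 2. The GLOBAL sharp upper window -/

/-- **GLOBAL SHARP UPPER END**: `negLogThetaNonarch I ≤ −ndegLgpSlotMin(T(I)) + U♯(I)`,
`U♯(I) := Σ_{p∈T(I)} (1/ℓ⋇)·Σ_j Σ_{v⃗} (d_I(v⃗) − max_b d_{v_b} + a_I(v⃗) + b_I(v⃗) + 1)·log p·Π_b Pr(v_b)` (inline). Unconditional.
[cite: Mochizuki2012, IUTchIV Thm. 1.10 Steps (v)–(viii) p. 27–30] [cite: DupuyHilado2025, Def. 3.6.3, §4.12] -/
theorem negLogThetaNonarch_le_upperWindowSharp :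
    I.negLogThetaNonarch ≤ -I.X.ndegLgpSlotMin I.supportPrimes
      + ∑ p ∈ I.supportPrimes, (1 / (I.X.lstar : ℝ)) * ∑ i : Fin I.X.lstar,
          ∑ e : Fin ((i : ℕ) + 1 + 1) → placesOver F₀ p,
            (if hp : p.Prime then
              haveI : Fact p.Prime := ⟨hp⟩
              (dSum p (fun b => (I.σ.localFieldFamily p hp).k (e b))
                - Finset.univ.sup' ⟨0, Finset.mem_univ _⟩
                    (fun b => differentOrd p ((I.σ.localFieldFamily p hp).k (e b)))
                + aSum p (fun b => (I.σ.localFieldFamily p hp).k (e b))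
                + bSum p (fun b => (I.σ.localFieldFamily p hp).k (e b)) + 1) * Real.log p
             else 0) * ∏ b, weight F₀ (e b).1 := by
  unfold ThetaVolumeInput.negLogThetaNonarch PilotData.ndegLgpSlotMin
  rw [← Finset.sum_neg_distrib, ← Finset.sum_add_distrib]
  refine Finset.sum_le_sum fun p hpT => ?_
  have hp' : p.Prime := I.prime_of_mem_supportPrimes hpT
  haveI hp : Fact p.Prime := ⟨hp'⟩
  simp only [dif_pos hp']
  rw [negLogThetaLoc_eq_sum, ← mul_neg, ← mul_add, ← Finset.sum_neg_distrib, ← Finset.sum_add_distrib]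
  refine mul_le_mul_of_nonneg_left (Finset.sum_le_sum fun i _ => ?_) (one_div_lstar_nonneg I)
  rw [← Finset.sum_neg_distrib, ← Finset.sum_add_distrib]
  refine Finset.sum_le_sum fun e _ => ?_
  rw [← neg_mul, ← add_mul]
  refine mul_le_mul_of_nonneg_right ?_ (prod_weight_nonneg e)
  exact logμ_le_neg_thetaMin_add_sup I i e

/-- **THE COMPUTABLE HALF WITH THE `✱`-SHARP CONSTANT**: `HullEstimateOf I (slotResidue(T(I)) + U♯(I))` for every genuine
input, unconditionally (`slotResidue = deĝ̲_lgp(P_Θ) − ndegLgpSlotMin`, Dupuy–Hilado Thm. 3.10.1).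
[cite: Mochizuki2012, IUTchIV Thm. 1.10 Steps (iv)–(viii) p. 26–30] [cite: DupuyHilado2025, Thm. 3.10.1, §4.12] -/
theorem hullEstimateOf_slotResidue_add_upperSharp :
    I.HullEstimateOf (I.X.slotResidue I.supportPrimes
      + ∑ p ∈ I.supportPrimes, (1 / (I.X.lstar : ℝ)) * ∑ i : Fin I.X.lstar,
          ∑ e : Fin ((i : ℕ) + 1 + 1) → placesOver F₀ p,
            (if hp : p.Prime then
              haveI : Fact p.Prime := ⟨hp⟩
              (dSum p (fun b => (I.σ.localFieldFamily p hp).k (e b))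
                - Finset.univ.sup' ⟨0, Finset.mem_univ _⟩
                    (fun b => differentOrd p ((I.σ.localFieldFamily p hp).k (e b)))
                + aSum p (fun b => (I.σ.localFieldFamily p hp).k (e b))
                + bSum p (fun b => (I.σ.localFieldFamily p hp).k (e b)) + 1) * Real.log p
             else 0) * ∏ b, weight F₀ (e b).1) := by
  have hu := negLogThetaNonarch_le_upperWindowSharp I
  have hs : I.X.slotResidue I.supportPrimes =
      LgpDivisor.ndegLgp I.X.thetaPilot - I.X.ndegLgpSlotMin I.supportPrimes := (DHData.ofInput I).slotResidue_eq
  unfold ThetaVolumeInput.HullEstimateOf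
  rw [hs]
  linarith

/-- **THE TWO-SIDED WINDOW, BOTH ENDS SHARP**: for every genuine input `I` and every `δ`,
`slotResidue + U♯ ≤ δ ⟹ HullEstimateOf I δ ⟹ slotResidue + D_expl ≤ δ` (lower side: abc-iut-S4's
`slotResidue_add_dExplicit_le_of_hullEstimateOf`). The band `U♯ − D_expl = Σ_p (1/ℓ⋇)Σ_jΣ_{v⃗} (Σ_{u|p} d(K_{u̲}) − max_b d_{v_b} +
a_I + b_I + 1)·log p·Π Pr` is, at a prime with ONE place `u` of `F₀` over it, exactly the tame constants `(a_I + b_I + 1)·log p`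
per collection. Pure packaging; nothing asserted about any input. [cite: Mochizuki2012, IUTchIV Thm. 1.10 Step (v) p. 27–28]
[cite: DupuyHilado2025, §4.12] -/
theorem hullEstimateOf_window_sharp (δ : ℝ) :
    (I.X.slotResidue I.supportPrimes
        + ∑ p ∈ I.supportPrimes, (1 / (I.X.lstar : ℝ)) * ∑ i : Fin I.X.lstar,
            ∑ e : Fin ((i : ℕ) + 1 + 1) → placesOver F₀ p,
              (if hp : p.Prime then
                haveI : Fact p.Prime := ⟨hp⟩
                (dSum p (fun b => (I.σ.localFieldFamily p hp).k (e b))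
                  - Finset.univ.sup' ⟨0, Finset.mem_univ _⟩
                      (fun b => differentOrd p ((I.σ.localFieldFamily p hp).k (e b)))
                  + aSum p (fun b => (I.σ.localFieldFamily p hp).k (e b))
                  + bSum p (fun b => (I.σ.localFieldFamily p hp).k (e b)) + 1) * Real.log p
               else 0) * ∏ b, weight F₀ (e b).1 ≤ δ → I.HullEstimateOf δ) ∧
    (I.HullEstimateOf δ →
      I.X.slotResidue I.supportPrimes
        + ∑ p ∈ I.supportPrimes, (1 / (I.X.lstar : ℝ)) * ∑ i : Fin I.X.lstar,
            ∑ e : Fin ((i : ℕ) + 1 + 1) → placesOver F₀ p,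
              (if hp : p.Prime then
                haveI : Fact p.Prime := ⟨hp⟩
                (dSum p (fun b => (I.σ.localFieldFamily p hp).k (e b))
                  - dSum p (fun u : placesOver F₀ p => (I.σ.localFieldFamily p hp).k u)) * Real.log p
               else 0) * ∏ b, weight F₀ (e b).1 ≤ δ) := by
  refine ⟨fun h => ?_, slotResidue_add_dExplicit_le_of_hullEstimateOf I⟩
  have h0 := hullEstimateOf_slotResidue_add_upperSharp I
  unfold ThetaVolumeInput.HullEstimateOf at h0 ⊢
  linarith

/-- **The deep regime with the `✱`-sharp constant**: `Cor312Of I ⟹ deĝ̲_lgp(P_Θ) − deĝ̲(P_q) ≤ slotResidue + U♯ +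
((l+5)/4)·log π` (sharpening the right side of `ForkGenuineRegimesSharp.cor312Of_sharpRegimes`). HYPOTHESIS = Cor. 3.12 at the
input only; nothing asserted. [claim: Mochizuki2012, status: disputed] -/
theorem gap_le_of_cor312Of_sharp (hc : I.Cor312Of) :
    LgpDivisor.ndegLgp I.X.thetaPilot - FinDivisor.ndeg F₀ I.X.qPilot ≤
      I.X.slotResidue I.supportPrimes
        + ∑ p ∈ I.supportPrimes, (1 / (I.X.lstar : ℝ)) * ∑ i : Fin I.X.lstar,
            ∑ e : Fin ((i : ℕ) + 1 + 1) → placesOver F₀ p,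
              (if hp : p.Prime then
                haveI : Fact p.Prime := ⟨hp⟩
                (dSum p (fun b => (I.σ.localFieldFamily p hp).k (e b))
                  - Finset.univ.sup' ⟨0, Finset.mem_univ _⟩
                      (fun b => differentOrd p ((I.σ.localFieldFamily p hp).k (e b)))
                  + aSum p (fun b => (I.σ.localFieldFamily p hp).k (e b))
                  + bSum p (fun b => (I.σ.localFieldFamily p hp).k (e b)) + 1) * Real.log p
               else 0) * ∏ b, weight F₀ (e b).1
        + ThetaVolumeInput.archLogTheta I.l := by
  have hu := negLogThetaNonarch_le_upperWindowSharp I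
  have hs : I.X.slotResidue I.supportPrimes =
      LgpDivisor.ndegLgp I.X.thetaPilot - I.X.ndegLgpSlotMin I.supportPrimes := (DHData.ofInput I).slotResidue_eq
  unfold ThetaVolumeInput.Cor312Of ThetaVolumeInput.negLogTheta ThetaVolumeInput.negAbsLogQ at hc
  rw [hs]
  linarith

end Upper

end Summit.ABC.IUTFork.GenuineContent

/-! ## 3. At the `λ`-line: the sharp SUFFICIENT condition for the hull-volume estimate (appended) -/

namespace Summit.ABC.IUTFork.PointDict

open Literature.NumberTheory.DiophantineGeometry.GenEll

variable {P : NFPoint} {l : ℕ}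

/-- **SUFFICIENT side at the `λ`-line**: if at EVERY genuine datum `T` of `(P, l)` the pilot-divisor/different arithmetic satisfies
`slotResidue(T) + U♯(T) ≤ δ` (`U♯` the `✱`-sharp constant of `negLogThetaNonarch_le_upperWindowSharp`), then `Cor22.HullVolumeAtDatum P l δ`
— the CONE binder `hvol`/`stub_hullRegimeAbove` at `(P, l)` with constant `δ` FOLLOWS from that arithmetic condition (the converse direction,
with `D_expl`, is abc-iut-S4's `PointDict.slotResidue_add_closedForm_le_of_hullVolumeAtDatum`). Nothing asserted about any point; no side taken.
[claim: Mochizuki2012, status: disputed] -/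
theorem hullVolumeAtDatum_of_forall_slotResidue_add_upperSharp_le {δ : ℝ}
    (h : ∀ T : Cor22.ThetaVolumeDatumAt P l,
      letI := T.instFieldF; letI := T.instNumberFieldF; letI := T.instFieldK; letI := T.instNumberFieldK
      letI := T.instAlgebraK; letI := T.instIsElliptic
      T.I.X.slotResidue T.I.supportPrimes
        + ∑ p ∈ T.I.supportPrimes, (1 / (T.I.X.lstar : ℝ)) * ∑ i : Fin T.I.X.lstar,
            ∑ e : Fin ((i : ℕ) + 1 + 1) → placesOver (Literature.IUT.HodgeTheaters.fieldOfModuli T.E) p,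
              (if hp : p.Prime then
                haveI : Fact p.Prime := ⟨hp⟩
                (dSum p (fun b => (T.I.σ.localFieldFamily p hp).k (e b))
                  - Finset.univ.sup' ⟨0, Finset.mem_univ _⟩
                      (fun b => differentOrd p ((T.I.σ.localFieldFamily p hp).k (e b)))
                  + aSum p (fun b => (T.I.σ.localFieldFamily p hp).k (e b))
                  + bSum p (fun b => (T.I.σ.localFieldFamily p hp).k (e b)) + 1) * Real.log p
               else 0) * ∏ b, weight (Literature.IUT.HodgeTheaters.fieldOfModuli T.E) (e b).1 ≤ δ) :
    Cor22.HullVolumeAtDatum P l δ := by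
  intro T
  letI := T.instFieldF; letI := T.instNumberFieldF; letI := T.instFieldK; letI := T.instNumberFieldK
  letI := T.instAlgebraK; letI := T.instIsElliptic
  exact (GenuineContent.hullEstimateOf_window_sharp T.I δ).1 (h T)

/-- **THE TWO-SIDED WINDOW AT THE `λ`-LINE, both ends sharp**: `(∀ T, slotResidue(T) + U♯(T) ≤ δ) ⟹ Cor22.HullVolumeAtDatum P l δ ⟹
(∀ T, slotResidue(T) + D_expl(T) ≤ δ)` — the CONE binder at `(P, l)` sits between two arithmetic conditions on the genuine data of the point,
differing per collection by `(Σ_{u|p} d(K_{u̲}) − max_b d_{v_b} + a_I + b_I + 1)·log p`. Pure packaging; no side taken. [claim: Mochizuki2012, status: disputed] -/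
theorem hullVolumeAtDatum_window_sharp (δ : ℝ) :
    ((∀ T : Cor22.ThetaVolumeDatumAt P l,
      letI := T.instFieldF; letI := T.instNumberFieldF; letI := T.instFieldK; letI := T.instNumberFieldK
      letI := T.instAlgebraK; letI := T.instIsElliptic
      T.I.X.slotResidue T.I.supportPrimes
        + ∑ p ∈ T.I.supportPrimes, (1 / (T.I.X.lstar : ℝ)) * ∑ i : Fin T.I.X.lstar,
            ∑ e : Fin ((i : ℕ) + 1 + 1) → placesOver (Literature.IUT.HodgeTheaters.fieldOfModuli T.E) p,
              (if hp : p.Prime then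
                haveI : Fact p.Prime := ⟨hp⟩
                (dSum p (fun b => (T.I.σ.localFieldFamily p hp).k (e b))
                  - Finset.univ.sup' ⟨0, Finset.mem_univ _⟩
                      (fun b => differentOrd p ((T.I.σ.localFieldFamily p hp).k (e b)))
                  + aSum p (fun b => (T.I.σ.localFieldFamily p hp).k (e b))
                  + bSum p (fun b => (T.I.σ.localFieldFamily p hp).k (e b)) + 1) * Real.log p
               else 0) * ∏ b, weight (Literature.IUT.HodgeTheaters.fieldOfModuli T.E) (e b).1 ≤ δ) →
      Cor22.HullVolumeAtDatum P l δ) ∧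
    (Cor22.HullVolumeAtDatum P l δ → ∀ T : Cor22.ThetaVolumeDatumAt P l,
      letI := T.instFieldF; letI := T.instNumberFieldF; letI := T.instFieldK; letI := T.instNumberFieldK
      letI := T.instAlgebraK; letI := T.instIsElliptic
      T.I.X.slotResidue T.I.supportPrimes
        + ∑ p ∈ T.I.supportPrimes, (1 / (T.I.X.lstar : ℝ)) * ∑ i : Fin T.I.X.lstar,
            ∑ e : Fin ((i : ℕ) + 1 + 1) → placesOver (Literature.IUT.HodgeTheaters.fieldOfModuli T.E) p,
              (if hp : p.Prime then
                haveI : Fact p.Prime := ⟨hp⟩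
                (dSum p (fun b => (T.I.σ.localFieldFamily p hp).k (e b))
                  - dSum p (fun u : placesOver (Literature.IUT.HodgeTheaters.fieldOfModuli T.E) p =>
                      (T.I.σ.localFieldFamily p hp).k u)) * Real.log p
               else 0) * ∏ b, weight (Literature.IUT.HodgeTheaters.fieldOfModuli T.E) (e b).1 ≤ δ) := by
  refine ⟨hullVolumeAtDatum_of_forall_slotResidue_add_upperSharp_le, fun h T => ?_⟩
  letI := T.instFieldF; letI := T.instNumberFieldF; letI := T.instFieldK; letI := T.instNumberFieldK
  letI := T.instAlgebraK; letI := T.instIsElliptic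
  exact (GenuineContent.hullEstimateOf_window_sharp T.I δ).2 (h T)

end Summit.ABC.IUTFork.PointDict

end
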